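import Literature.Analysis.Complex.Osgood
import Literature.Analysis.Complex.SeveralVariables
import Mathlib.Analysis.Complex.TaylorSeries
import Mathlib.Analysis.Complex.Exponential
import Mathlib.Analysis.Complex.ExponentialBounds
import Mathlib.Analysis.Analytic.ConvergenceRadius
import HarnessLib

/-!
# Osgood's lemma: complex-differentiable functions of several variables are analytic (proof)

Discharge of the named fact `Literature.Analysis.Complex.osgoodLemma` (`Literature/Analysis/Complex/Osgood.lean`;
Hörmander, *An Introduction to Complex Analysis in Several Variables*, Thms. 2.2.1 and 2.2.6):
a complex-valued function complex differentiable on an open subset `U` of a finite-dimensional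
complex normed space is analytic on `U` (`osgoodLemma_holds`).

## Proof

Not the printed one (polydisc Cauchy formula, absent from Mathlib) but the classical
"Cauchy estimates + one complex line at a time" argument, built on the sibling
`SeveralVariables.lean` (holomorphic ⇒ `C^∞`, Cauchy estimate for directional derivatives, slices)
and Mathlib's one-variable Taylor theorem `Complex.hasSum_taylorSeries_on_ball`:

1. `f` is `C^∞` on `U` (`Literature.Analysis.Complex.SCV.contDiffOn_infty`), so the candidate power series at `x ∈ U` is
   `p n = (n!)⁻¹ • Dⁿf(x)` (`taylorFPowerSeries`).
2. **Cauchy estimates for the operator norms** (`norm_iteratedFDeriv_le_of_closedBall`): if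
   `‖f‖ ≤ M` on `closedBall x ρ ⊆ U` then `‖Dʲ f (x')‖ ≤ M δ⁻ʲ` on `closedBall x (ρ − jδ)`, by
   induction on `j` — `D^{j+1} f = D(Dʲ f)` (`norm_fderiv_iteratedFDeriv`) and the Cauchy estimate
   `Literature.Analysis.Complex.SCV.norm_fderiv_apply_le` for the holomorphic Banach-valued map `Dʲ f` on discs of radius
   `δ`; with `δ = ρ/(n+1)` this gives `‖p n‖ ≤ M (n+1)ⁿ/(n! ρⁿ) ≤ M e (e/ρ)ⁿ`, so the radius of
   convergence of `p` is at least `ρ/3` (`pow_div_factorial_le_exp`).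
3. **Convergence to `f` along complex lines**: for `‖y‖ < ρ/3` the slice `t ↦ f (x + t y)` is
   holomorphic on the disc `|t| < 2`, so `f (x + y) = ∑ (n!)⁻¹ (dⁿ/dtⁿ) f(x + t y)|₀`
   (`Complex.hasSum_taylorSeries_on_ball`), and `(dⁿ/dtⁿ) f (x + t y)|₀ = ∂_yⁿ f (x)`
   (`Literature.Analysis.Complex.SCV.iteratedDeriv_slice_eqOn`) `= Dⁿ f(x)(y, …, y)`
   (`iterate_fderiv_apply_eq_iteratedFDeriv`).
4. Hence `HasFPowerSeriesOnBall f p x (ρ/3)` and `f` is analytic at `x`.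

## References

* L. Hörmander, *An Introduction to Complex Analysis in Several Variables* (1973), Thm. 2.2.1,
  Thm. 2.2.6, Thm. 2.2.7 (Cauchy's inequalities). [HormanderSCV1973]
* W. F. Osgood, Math. Ann. 52 (1899) 462–464.
-/

noncomputable section

open Complex Metric Set Filter
open scoped Topology Real ContDiff NNReal ENNReal

namespace Literature.Analysis.Complex

namespace SCV

variable {E : Type*} [NormedAddCommGroup E] [NormedSpace ℂ E]
  {F : Type*} [NormedAddCommGroup F] [NormedSpace ℂ F] [CompleteSpace F]

/-! ### Iterated directional derivatives are diagonal values of the iterated Fréchet derivative -/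

omit [CompleteSpace F] in
/-- For a function `C^∞` on an open set, the iterated directional derivative `∂_vᵏ f (x)` is the
`k`-th Fréchet derivative evaluated on the diagonal, `Dᵏ f (x) (v, …, v)`. [folklore] -/
theorem iterate_fderiv_apply_eq_iteratedFDeriv {f : E → F} {U : Set E} (hU : IsOpen U)
    (hf : ContDiffOn ℂ ∞ f U) (v : E) (k : ℕ) {x : E} (hx : x ∈ U) :
    ((fderiv ℂ · · v)^[k] f) x = iteratedFDeriv ℂ k f x fun _ => v := by
  induction k generalizing f x with
  | zero => simp
  | succ k ih =>
    rw [Function.iterate_succ_apply, iteratedFDeriv_succ_apply_right]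
    have hf' : ContDiffOn ℂ ∞ (fderiv ℂ f) U := hf.fderiv_of_isOpen hU le_rfl
    have hfv : ContDiffOn ℂ ∞ (fun y => fderiv ℂ f y v) U :=
      (ContinuousLinearMap.apply ℂ F v).contDiff.comp_contDiffOn hf'
    rw [ih hfv hx]
    -- commute the evaluation at `v` with the iterated derivative
    have hcomp : (fun y => fderiv ℂ f y v) = (ContinuousLinearMap.apply ℂ F v) ∘ (fderiv ℂ f) := rfl
    have h1 : iteratedFDeriv ℂ k (fun y => fderiv ℂ f y v) x =
        (ContinuousLinearMap.apply ℂ F v).compContinuousMultilinearMap (iteratedFDeriv ℂ k (fderiv ℂ f) x) := by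
      rw [hcomp]
      exact (ContinuousLinearMap.apply ℂ F v).iteratedFDeriv_comp_left
        ((hf' x hx).contDiffAt (hU.mem_nhds hx)) (mod_cast le_top)
    rw [h1]
    simp only [ContinuousLinearMap.compContinuousMultilinearMap_coe, Function.comp_apply,
      ContinuousLinearMap.apply_apply]
    rfl

/-! ### Cauchy estimates for the operator norms of the iterated derivatives -/

/-- The iterated Fréchet derivatives of a holomorphic function are holomorphic (finite-dimensional
domain). [folklore] -/
theorem differentiableOn_iteratedFDeriv [FiniteDimensional ℂ E] {f : E → F} {U : Set E}
    (hf : DifferentiableOn ℂ f U) (hU : IsOpen U) (j : ℕ) :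
    DifferentiableOn ℂ (iteratedFDeriv ℂ j f) U := by
  have hC : ContDiffOn ℂ ∞ f U := contDiffOn_infty hf hU
  have h := hC.differentiableOn_iteratedFDerivWithin (m := j) (mod_cast ENat.coe_lt_top j)
    hU.uniqueDiffOn
  exact h.congr fun x hx => (iteratedFDerivWithin_of_isOpen j hU hx).symm

/-- **Cauchy estimates for the iterated derivatives** (Hörmander (1973), Thm. 2.2.7, operator-norm
form): if `f` is holomorphic on an open `U ⊇ closedBall x ρ` and `‖f‖ ≤ M` on `closedBall x ρ`,
then for `δ > 0` and `j δ ≤ ρ`, `‖Dʲ f (x')‖ ≤ M / δʲ` for all `x' ∈ closedBall x (ρ − j δ)`.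
[cite: HormanderSCV1973, Thm 2.2.7] -/
theorem norm_iteratedFDeriv_le_of_closedBall [FiniteDimensional ℂ E] {f : E → F} {U : Set E}
    (hf : DifferentiableOn ℂ f U) (hU : IsOpen U) {x : E} {ρ M δ : ℝ} (hρU : closedBall x ρ ⊆ U)
    (hM : ∀ z ∈ closedBall x ρ, ‖f z‖ ≤ M) (hδ : 0 < δ) (j : ℕ) (hj : (j : ℝ) * δ ≤ ρ)
    {x' : E} (hx' : x' ∈ closedBall x (ρ - j * δ)) :
    ‖iteratedFDeriv ℂ j f x'‖ ≤ M / δ ^ j := by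
  induction j generalizing x' with
  | zero =>
    rw [pow_zero, div_one, norm_iteratedFDeriv_zero]
    exact hM x' (by simpa using hx')
  | succ j ih =>
    have hjδ : (j : ℝ) * δ ≤ ρ := by
      have : (j : ℝ) * δ ≤ (j + 1 : ℕ) * δ := by gcongr; omega
      exact this.trans (by exact_mod_cast hj)
    have hM0 : 0 ≤ M := (norm_nonneg _).trans (hM x (mem_closedBall_self ((by positivity : (0:ℝ) ≤ (0:ℕ) * δ).trans (by simpa using hjδ.trans' (by nlinarith [hδ.le] : (0:ℝ) * δ ≤ j * δ)))))
    -- points of the disc of radius `δ` around `x'` in a unit direction lie in the previous ball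
    have hmem : ∀ v : E, ‖v‖ ≤ 1 → ∀ t ∈ closedBall (0 : ℂ) δ,
        x' + t • v ∈ closedBall x (ρ - j * δ) := by
      intro v hv t ht
      rw [mem_closedBall, dist_zero_right] at ht
      rw [mem_closedBall] at hx' ⊢
      calc dist (x' + t • v) x ≤ dist (x' + t • v) x' + dist x' x := dist_triangle _ _ _
        _ = ‖t • v‖ + dist x' x := by rw [dist_eq_norm, add_sub_cancel_left]
        _ ≤ δ * 1 + (ρ - (j + 1 : ℕ) * δ) := by
            gcongr
            rw [norm_smul]
            exact mul_le_mul ht hv (norm_nonneg _) hδ.le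
        _ = ρ - j * δ := by push_cast; ring
    have hsubU : closedBall x (ρ - j * δ) ⊆ U :=
      (closedBall_subset_closedBall (by nlinarith [hδ.le, (Nat.cast_nonneg j : (0:ℝ) ≤ j)])).trans hρU
    -- Cauchy estimate for the holomorphic map `Dʲ f` in each unit direction
    have hD := differentiableOn_iteratedFDeriv hf hU j
    have hbound : ∀ v : E, ‖v‖ ≤ 1 → ‖fderiv ℂ (iteratedFDeriv ℂ j f) x' v‖ ≤ (M / δ ^ j) / δ := by
      intro v hv
      refine norm_fderiv_apply_le hD hU hδ (fun t ht => hsubU (hmem v hv t ht)) fun t ht => ?_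
      exact ih hjδ (hmem v hv t (sphere_subset_closedBall ht))
    have hop : ‖fderiv ℂ (iteratedFDeriv ℂ j f) x'‖ ≤ (M / δ ^ j) / δ :=
      opNorm_le_of_unit_ball _ (by positivity) hbound
    rw [← norm_fderiv_iteratedFDeriv, pow_succ, ← div_div]
    exact hop

/-! ### The Taylor power series and its radius -/

/-- The formal Taylor series `p n = (n!)⁻¹ • Dⁿ f (x)` of `f` at `x`, i.e. Mathlib's
`ftaylorSeries ℂ f x` rescaled by the factorials (the normalisation of `HasFPowerSeriesOnBall`,
cf. `HasFPowerSeriesOnBall.factorial_smul`). [folklore] -/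
def taylorFPowerSeries (f : E → F) (x : E) : FormalMultilinearSeries ℂ E F :=
  fun n => ((n.factorial : ℂ))⁻¹ • ftaylorSeries ℂ f x n

omit [CompleteSpace F] in
/-- `taylorFPowerSeries f x n m = (n!)⁻¹ • Dⁿ f (x) m`. [folklore] -/
@[simp]
theorem taylorFPowerSeries_apply (f : E → F) (x : E) (n : ℕ) (m : Fin n → E) :
    taylorFPowerSeries f x n m = ((n.factorial : ℂ))⁻¹ • iteratedFDeriv ℂ n f x m := rfl

omit [CompleteSpace F] in
/-- `taylorFPowerSeries f x n = (n!)⁻¹ • Dⁿ f (x)` (`ftaylorSeries` unfolded). [folklore] -/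
theorem taylorFPowerSeries_eq (f : E → F) (x : E) (n : ℕ) :
    taylorFPowerSeries f x n = ((n.factorial : ℂ))⁻¹ • iteratedFDeriv ℂ n f x := rfl

/-- `(n+1)ⁿ / n! ≤ e^{n+1}`. [folklore] -/
theorem succ_pow_div_factorial_le_exp (n : ℕ) :
    ((n + 1 : ℝ) ^ n) / n.factorial ≤ Real.exp (n + 1) := by
  have h := Real.pow_div_factorial_le_exp (x := (n + 1 : ℝ)) (by positivity) (n + 1)
  have hfac : ((n + 1).factorial : ℝ) = (n + 1) * n.factorial := by push_cast [Nat.factorial_succ]; ring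
  rw [hfac, pow_succ, mul_comm ((n + 1 : ℝ) ^ n), mul_div_mul_left _ _ (by positivity)] at h
  exact h

/-- **Cauchy bound for the Taylor coefficients**: with `‖f‖ ≤ M` on `closedBall x ρ ⊆ U`,
`‖p n‖ ≤ M e (e / ρ)ⁿ`. [cite: HormanderSCV1973, Thm 2.2.7] -/
theorem norm_taylorFPowerSeries_le [FiniteDimensional ℂ E] {f : E → F} {U : Set E}
    (hf : DifferentiableOn ℂ f U) (hU : IsOpen U) {x : E} {ρ M : ℝ} (hρ : 0 < ρ)
    (hρU : closedBall x ρ ⊆ U) (hM : ∀ z ∈ closedBall x ρ, ‖f z‖ ≤ M) (n : ℕ) :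
    ‖taylorFPowerSeries f x n‖ ≤ M * Real.exp 1 * (Real.exp 1 / ρ) ^ n := by
  have hM0 : 0 ≤ M := (norm_nonneg _).trans (hM x (mem_closedBall_self hρ.le))
  set δ : ℝ := ρ / (n + 1) with hδ
  have hδpos : 0 < δ := by positivity
  have hnδ : (n : ℝ) * δ ≤ ρ := by
    rw [hδ, mul_div_assoc']
    rw [div_le_iff₀ (by positivity)]
    nlinarith
  have hx : x ∈ closedBall x (ρ - n * δ) := mem_closedBall_self (by nlinarith)
  have h1 := norm_iteratedFDeriv_le_of_closedBall hf hU hρU hM hδpos n hnδ hx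
  -- `‖p n‖ = ‖Dⁿf x‖ / n!`
  have hnorm : ‖taylorFPowerSeries f x n‖ = ‖iteratedFDeriv ℂ n f x‖ / n.factorial := by
    rw [taylorFPowerSeries, norm_smul, norm_inv, Complex.norm_natCast, div_eq_inv_mul]
    rfl
  rw [hnorm, div_le_iff₀ (by positivity)]
  calc ‖iteratedFDeriv ℂ n f x‖ ≤ M / δ ^ n := h1
    _ = M * ((n + 1 : ℝ) ^ n / ρ ^ n) := by
        rw [hδ, div_pow, div_div_eq_mul_div]
        ring
    _ = M * (((n + 1 : ℝ) ^ n / n.factorial) * n.factorial) / ρ ^ n := by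
        rw [div_mul_cancel₀ _ (by positivity)]
        ring
    _ ≤ M * (Real.exp (n + 1) * n.factorial) / ρ ^ n := by
        gcongr
        exact succ_pow_div_factorial_le_exp n
    _ = M * Real.exp 1 * (Real.exp 1 / ρ) ^ n * n.factorial := by
        rw [show (n + 1 : ℝ) = n * 1 + 1 by ring, Real.exp_add, Real.exp_nat_mul, div_pow]
        ring

/-- **Lower bound for the radius of convergence** of the Taylor series: at least `ρ/3`. [folklore] -/
theorem le_radius_taylorFPowerSeries [FiniteDimensional ℂ E] {f : E → F} {U : Set E}
    (hf : DifferentiableOn ℂ f U) (hU : IsOpen U) {x : E} {ρ M : ℝ} (hρ : 0 < ρ)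
    (hρU : closedBall x ρ ⊆ U) (hM : ∀ z ∈ closedBall x ρ, ‖f z‖ ≤ M) :
    ENNReal.ofReal (ρ / 3) ≤ (taylorFPowerSeries f x).radius := by
  rw [ENNReal.ofReal]
  refine FormalMultilinearSeries.le_radius_of_bound _ (M * Real.exp 1) fun n => ?_
  rw [Real.coe_toNNReal _ (by positivity)]
  have hM0 : 0 ≤ M := (norm_nonneg _).trans (hM x (mem_closedBall_self hρ.le))
  have h := norm_taylorFPowerSeries_le hf hU hρ hρU hM n
  have he3 : Real.exp 1 / ρ * (ρ / 3) ≤ 1 := by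
    rw [div_mul_div_comm, mul_comm (Real.exp 1), mul_div_mul_left _ _ hρ.ne']
    rw [div_le_one (by norm_num)]
    linarith [Real.exp_one_lt_three]
  calc ‖taylorFPowerSeries f x n‖ * (ρ / 3) ^ n
      ≤ M * Real.exp 1 * (Real.exp 1 / ρ) ^ n * (ρ / 3) ^ n := by
        gcongr
    _ = M * Real.exp 1 * (Real.exp 1 / ρ * (ρ / 3)) ^ n := by rw [mul_pow]; ring
    _ ≤ M * Real.exp 1 * 1 ^ n := by
        gcongr
    _ = M * Real.exp 1 := by rw [one_pow, mul_one]

/-! ### Convergence of the Taylor series along complex lines; analyticity -/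

/-- **The Taylor series converges to `f`** on the ball of radius `ρ/3`: restrict to the complex
line through `x` and `x + y` and use the one-variable Taylor theorem
(`Complex.hasSum_taylorSeries_on_ball`); the `n`-th derivative of the slice at `0` is
`∂_yⁿ f (x) = Dⁿ f (x) (y, …, y)`. [cite: HormanderSCV1973, Thm 2.2.6] -/
theorem hasSum_taylorFPowerSeries [FiniteDimensional ℂ E] {f : E → F} {U : Set E}
    (hf : DifferentiableOn ℂ f U) (hU : IsOpen U) {x : E} {ρ : ℝ} (hρ : 0 < ρ)
    (hρU : closedBall x ρ ⊆ U) {y : E} (hy : ‖y‖ < ρ / 3) :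
    HasSum (fun n => taylorFPowerSeries f x n fun _ => y) (f (x + y)) := by
  -- the slice through `x` in direction `y` is differentiable on the disc `|t| < 2`
  have hsub : ∀ t ∈ ball (0 : ℂ) 2, x + t • y ∈ U := by
    intro t ht
    apply hρU
    rw [mem_ball, dist_zero_right] at ht
    rw [mem_closedBall, dist_eq_norm, add_sub_cancel_left, norm_smul]
    nlinarith [norm_nonneg t, norm_nonneg y]
  have hd : DifferentiableOn ℂ (fun t : ℂ => f (x + t • y)) (ball 0 2) :=
    (differentiableOn_slice hf x y).mono hsub
  have h1 : (1 : ℂ) ∈ ball (0 : ℂ) 2 := by simp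
  have hsum := Complex.hasSum_taylorSeries_on_ball hd h1
  have hC : ContDiffOn ℂ ∞ f U := contDiffOn_infty hf hU
  have hx : x ∈ U := hρU (mem_closedBall_self hρ.le)
  have h0 : (0 : ℂ) ∈ {t : ℂ | x + t • y ∈ U} := by simpa using hx
  simp only [one_smul, sub_zero, one_pow] at hsum
  convert hsum using 1
  funext n
  rw [iteratedDeriv_slice_eqOn hf hU x y n h0]
  beta_reduce
  rw [zero_smul, add_zero, iterate_fderiv_apply_eq_iteratedFDeriv hU hC y n hx,
    taylorFPowerSeries_apply]

/-- **The Taylor series represents `f` on a ball** (quantitative Osgood lemma): if `f` is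
holomorphic on an open `U ⊇ closedBall x ρ`, `ρ > 0`, then
`HasFPowerSeriesOnBall f (taylorFPowerSeries f x) x (ρ/3)`. [cite: HormanderSCV1973, Thm 2.2.6] -/
theorem hasFPowerSeriesOnBall_taylorFPowerSeries [FiniteDimensional ℂ E] {f : E → F} {U : Set E}
    (hf : DifferentiableOn ℂ f U) (hU : IsOpen U) {x : E} {ρ : ℝ} (hρ : 0 < ρ)
    (hρU : closedBall x ρ ⊆ U) :
    HasFPowerSeriesOnBall f (taylorFPowerSeries f x) x (ENNReal.ofReal (ρ / 3)) := by
  -- a bound for `f` on the compact ball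
  haveI : ProperSpace E := FiniteDimensional.proper_rclike ℂ E
  obtain ⟨M, hM⟩ : ∃ M, ∀ z ∈ closedBall x ρ, ‖f z‖ ≤ M :=
    (isCompact_closedBall x ρ).exists_bound_of_continuousOn (hf.continuousOn.mono hρU)
  refine ⟨le_radius_taylorFPowerSeries hf hU hρ hρU hM, by simp [hρ], fun {y} hy => ?_⟩
  rw [Metric.eball_ofReal, mem_ball, dist_zero_right] at hy
  exact hasSum_taylorFPowerSeries hf hU hρ hρU hy

/-- **Osgood's lemma**: a function complex differentiable on an open subset of a
finite-dimensional complex normed space is analytic at every point of it. [cite: HormanderSCV1973, Thm 2.2.1 and Thm 2.2.6] -/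
theorem analyticAt_of_differentiableOn [FiniteDimensional ℂ E] {f : E → F} {U : Set E}
    (hf : DifferentiableOn ℂ f U) (hU : IsOpen U) {x : E} (hx : x ∈ U) : AnalyticAt ℂ f x := by
  obtain ⟨ε, hε, hεU⟩ := Metric.isOpen_iff.1 hU x hx
  have hρU : closedBall x (ε / 2) ⊆ U := (closedBall_subset_ball (by linarith)).trans hεU
  exact (hasFPowerSeriesOnBall_taylorFPowerSeries hf hU (by positivity) hρU).analyticAt

/-- **Osgood's lemma, set form**: holomorphic on an open set ⇒ analytic on it. [cite: HormanderSCV1973, Thm 2.2.1 and Thm 2.2.6] -/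
theorem analyticOnNhd_of_differentiableOn [FiniteDimensional ℂ E] {f : E → F} {U : Set E}
    (hf : DifferentiableOn ℂ f U) (hU : IsOpen U) : AnalyticOnNhd ℂ f U :=
  fun _ hx => analyticAt_of_differentiableOn hf hU hx

/-- For an open set in finite dimension, analytic and complex differentiable are the same. [folklore] -/
theorem analyticOnNhd_iff_differentiableOn [FiniteDimensional ℂ E] {f : E → F} {U : Set E}
    (hU : IsOpen U) : AnalyticOnNhd ℂ f U ↔ DifferentiableOn ℂ f U :=
  ⟨fun h => h.differentiableOn, fun h => analyticOnNhd_of_differentiableOn h hU⟩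

end SCV

/-- **Discharge of the named fact `osgoodLemma`** (Hörmander (1973), Thms. 2.2.1, 2.2.6):
complex differentiable on an open set of a finite-dimensional complex normed space implies
analytic. [cite: HormanderSCV1973, Thm 2.2.1 and Thm 2.2.6] -/
theorem osgoodLemma_holds (E : Type*) [NormedAddCommGroup E] [NormedSpace ℂ E]
    [FiniteDimensional ℂ E] : osgoodLemma E :=
  fun _ _ hU hf => SCV.analyticOnNhd_of_differentiableOn hf hU

end Literature.Analysis.Complex
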